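import Literature.NumberTheory.Automorphic.AutomorphicGLnFlathProofs
import Literature.NumberTheory.Automorphic.IrreducibleClassesConstituents
import Literature.NumberTheory.Automorphic.RestrictedProductBoxes
import HarnessLib

/-!
# The local factor of a restricted tensor product OCCURS in the slot restriction: `⟦ρᵢ⟧ ∈ JH(π|_{Gᵢ})`

Topic `NumberTheory/Automorphic`; namespace `Literature.NumberTheory.Automorphic`.  Let `(W, π, j)` be a restricted tensor product
`π ≅ ⊗'_l (ρ l, x₀ l)` of complex representations of a restricted product `Πʳ l, [G l, K l]` (★ `IsRestrictedTensorProductRep`,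
[Flath1979 §2 Example 2, Thm. 3; Bump1997 §3.4]) with `W ≠ 0`, and let the factor `ρ i` be irreducible and smooth.  Then the
CLASS `⟦ρ i⟧ ∈ Irr(G i)` (★ `IrrClass.mk`) is a CONSTITUENT (★ `IrrClass.IsConstituentOf`: the class of an irreducible smooth
subquotient) of the slot restriction `π ∘ ι_i` (`ι_i = mulSingleHom K i : G i →* Πʳ l, [G l, K l]`, ★ `RestrictedProductBoxes`):
indeed `ρ i` EMBEDS — the slot map `φ_y : v ↦ j (y.update i v)` (★ `exists_intertwiningMap_slot`) at a family `y` with `j y ≠ 0` is a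
non-zero `G i`-map out of an irreducible representation, hence injective (Schur, Mathlib `Representation.IsIrreducible.injective_or_eq_zero`),
and an irreducible smooth representation occurring in `σ` is a constituent of `σ` (★ `IrrClass.isConstituentOf_mk_of_injective`).
This is the token «the local type at `v` of `⊗'_v π_v` is `π_v`» used to identify the local factors of an automorphic representation
with its chosen local constituent classes ([Flath1979 Thm. 3]; [Rogawski1990 §14.5 p. 237]; cell `hodgecm-mathlib`, road «TF», P5∕J1).
Theorems only; no instance, no notation, no `sorry`.

## References
* D. Flath, *Decomposition of representations into tensor products*, Corvallis 1979, part 1, §2 Example 2, Thm. 3 [Flath1979].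
* D. Bump, *Automorphic Forms and Representations* (1997), §3.4 Thm. 3.4.4 [Bump1997].
* J. Rogawski, *Automorphic Representations of Unitary Groups in Three Variables* (1990), §14.5 p. 237 [Rogawski1990].
-/

open scoped RestrictedProduct
open Filter

namespace Literature.NumberTheory.Automorphic

universe u uG w

section Slot

variable {ι : Type u} {G : ι → Type uG} [∀ i, Group (G i)] [∀ i, TopologicalSpace (G i)]
  {K : ∀ i, Subgroup (G i)} {V : ι → Type} [∀ i, AddCommGroup (V i)] [∀ i, Module ℂ (V i)]
  {ρ : ∀ i, Representation ℂ (G i) (V i)} {x₀ : ∀ i, V i} [DecidableEq ι]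
  {W : Type w} [AddCommGroup W] [Module ℂ W] {π : Representation ℂ (Πʳ i, [G i, K i]) W}
  {hx₀ : ∀ᶠ i in cofinite, x₀ i ∈ (ρ i).fixedPoints (K i)}
  {j : RestrictedFamily V x₀ → W} {S₀ : Finset ι}

namespace IsRestrictedTensorProductRep

omit [∀ i, TopologicalSpace (G i)] in
/-- **A non-zero value of the structure map** exists when `W ≠ 0` (the values `j y` span `W`). [cite: Flath1979, §2 Example 2] -/
theorem exists_apply_ne_zero [Nontrivial W] (h : IsRestrictedTensorProductRep ρ π hx₀ j S₀) : ∃ y : RestrictedFamily V x₀, j y ≠ 0 := by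
  by_contra! hall
  have htop := h.isRestrictedTensorProduct.span_range_eq_top
  rw [Submodule.span_eq_bot.2 (by rintro _ ⟨y, rfl⟩; exact hall y)] at htop
  exact bot_ne_top htop

omit [∀ i, TopologicalSpace (G i)] in
/-- **The irreducible factor `ρ i` EMBEDS into the slot restriction `π ∘ ι_i`** (`W ≠ 0`): some slot map `v ↦ j (y.update i v)` is an
INJECTIVE `G i`-intertwining map `ρ i → π ∘ ι_i` (Schur). [cite: Flath1979, §2 Example 2; Thm. 3] [cite: Bump1997, Thm. 3.4.4] -/
theorem exists_injective_intertwiningMap_slot [Nontrivial W] (h : IsRestrictedTensorProductRep ρ π hx₀ j S₀) (i : ι)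
    (hirr : (ρ i).IsIrreducible) :
    ∃ T : (ρ i).IntertwiningMap (π.comp (mulSingleHom K i)), Function.Injective T := by
  haveI : (ρ i).IsIrreducible := hirr
  obtain ⟨y, hy⟩ := h.exists_apply_ne_zero
  obtain ⟨T, hT⟩ := h.exists_intertwiningMap_slot y i
  have hT0 : T ≠ 0 := by
    intro hT0
    apply hy
    rw [← y.update_eq_self i, ← hT (y i), hT0]
    rfl
  exact ⟨T, (Representation.IsIrreducible.injective_or_eq_zero T).resolve_right hT0⟩

/-- **`⟦ρ i⟧` IS A CONSTITUENT OF THE SLOT RESTRICTION `π ∘ ι_i`** of a restricted tensor product `π ≅ ⊗'_l (ρ l, x₀ l)` on `W ≠ 0`,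
for `ρ i` irreducible and smooth — the local factor occurs in (indeed embeds into) the restriction of `π` to the `i`-th coordinate
subgroup. [cite: Flath1979, Thm. 3] [cite: Bump1997, Thm. 3.4.4] [cite: Rogawski1990, §14.5 p. 237] -/
theorem mk_isConstituentOf_comp_mulSingleHom [Nontrivial W] (h : IsRestrictedTensorProductRep ρ π hx₀ j S₀) (i : ι)
    (hirr : (ρ i).IsIrreducible) (hsm : (ρ i).IsSmooth) :
    (IrrClass.mk { V := V i, ρ := ρ i, isIrreducible := hirr, isSmooth := hsm }).IsConstituentOf (π.comp (mulSingleHom K i)) := by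
  obtain ⟨T, hT⟩ := h.exists_injective_intertwiningMap_slot i hirr
  exact IrrClass.isConstituentOf_mk_of_injective hirr hsm T hT

/-- **Uniqueness form**: every class `c ∈ Irr(G i)` equal to `⟦ρ i⟧` (e.g. the class of any representation equivalent to `ρ i`) is a
constituent of `π ∘ ι_i`. [cite: Flath1979, Thm. 3] -/
theorem isConstituentOf_comp_mulSingleHom_of_mk_eq [Nontrivial W] (h : IsRestrictedTensorProductRep ρ π hx₀ j S₀) (i : ι)
    (hirr : (ρ i).IsIrreducible) (hsm : (ρ i).IsSmooth) {c : IrrClass (G i)}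
    (hc : IrrClass.mk { V := V i, ρ := ρ i, isIrreducible := hirr, isSmooth := hsm } = c) :
    c.IsConstituentOf (π.comp (mulSingleHom K i)) :=
  hc ▸ h.mk_isConstituentOf_comp_mulSingleHom i hirr hsm

end IsRestrictedTensorProductRep

end Slot

end Literature.NumberTheory.Automorphic
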